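import Mathlib
import Literature.AlgebraicGeometry.Resolution.SmoothStalksRegular
import HarnessLib

/-!
# `EquisingularLift`, line `strata-split` — the special fibre of a smooth `U → Spec O` is not reduced to a section point

Crux `stmt-ResolutionOfSingularities-15660` = `Theses.EquisingularLift.EquisingularLift`; tools for the helper
sub-goal `isIrreducible_specialFibre_of_isBlowup_section` (L1) of the registered stub `stub_resolveOnePoint_dimOne`
(section blow-up calculus over a DVR; file `EquisingularLiftEquisingularLiftSectionBlowupIrreducible`).

* `isPreirreducible_of_subset_closure`, `isPreirreducible_inter_of_isOpen`,
  `isPreirreducible_preimage_of_isInducing` — three elementary facts on (pre)irreducible sets;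
* `exists_mem_specialFibre_ne_of_section` (registered sub-goal) — for a discrete valuation ring `O` with closed
  point `s₀`, an integral scheme `U`, a smooth separated `r : U → Spec O` and a section `s` of `r` whose ideal
  sheaf `ker s` is nonzero, the special fibre `r⁻¹(s₀)` has a point other than `s(s₀)`.

Proof of the last fact. Suppose `r⁻¹(s₀) = {z₁}`, `z₁ = s(s₀)`. Take an affine open `V = Spec R ∋ z₁`; then
`ρ : O → R` is smooth (Mathlib's `Smooth`), `R` is a Noetherian domain, and `s` factors through `V`. Let `ϖ` be a
uniformizer and `p = ρ(ϖ)`. A point of `V` lies over `s₀` iff its prime contains `p`; so the prime `𝔭₁` of `z₁` is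
the only prime of `R` containing `p`. The ring `R/pR ≅ κ ⊗_O R` is smooth over the residue field `κ`, hence reduced
(`isReduced_of_smooth`, Stacks 056S), so its nilradical `𝔭₁/pR` vanishes: `𝔭₁ = pR`. The ideal `I = ker (R → O)` of
the section is prime (`O` is a domain), nonzero (else `V ⊆ s(Spec O)`, and `V` is dense, forcing `ker s = ⊥`),
contained in `𝔭₁`, and `p ∉ I` (the section pulls `p` back to `ϖ ≠ 0`). From `I ⊆ 𝔭₁ = pR`, `p ∉ I` and primality,
`I = pI`, so `I ⊆ ⋂ₙ pⁿR = 0` by Krull's intersection theorem — a contradiction. (Geometrically: `U → Spec O` would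
be étale at `z₁` and the section an open immersion, so `ker s = ⊥` on the integral `U`.)

References: The Stacks Project, Tag 056S (a scheme smooth over a field is regular); W. Krull's intersection
theorem (Mathlib `Ideal.iInf_pow_eq_bot_of_isDomain`); Q. Liu, *Algebraic Geometry and Arithmetic Curves* (2002),
§8.1 (blowing-ups along sections over a Dedekind base, where the fact is used).
-/

set_option linter.dupNamespace false -- mandated namespace `Summit.<Summit>.<Problem>` of this single-conjunct summit
set_option linter.overlappingInstances false -- the registered signature carries both [IsDomain O] and [IsDiscreteValuationRing O]

noncomputable section

open CategoryTheory CategoryTheory.Limits AlgebraicGeometry TopologicalSpace Topology TensorProduct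
open Literature.AlgebraicGeometry.Resolution

namespace Summit.ResolutionOfSingularities.ResolutionOfSingularities.Cruxes.EquisingularLift.StrataSplit

/-! ## Three topological lemmas -/

/-- A set squeezed between a preirreducible set and its closure is preirreducible. [folklore] -/
theorem isPreirreducible_of_subset_closure {X : Type*} [TopologicalSpace X] {A S : Set X}
    (hA : IsPreirreducible A) (hAS : A ⊆ S) (hS : S ⊆ closure A) : IsPreirreducible S := by
  rintro u v hu hv ⟨x, hxS, hxu⟩ ⟨y, hyS, hyv⟩
  obtain ⟨x', hx'u, hx'A⟩ := mem_closure_iff.mp (hS hxS) u hu hxu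
  obtain ⟨y', hy'v, hy'A⟩ := mem_closure_iff.mp (hS hyS) v hv hyv
  obtain ⟨z, hzA, hz⟩ := hA u v hu hv ⟨x', hx'A, hx'u⟩ ⟨y', hy'A, hy'v⟩
  exact ⟨z, hAS hzA, hz⟩

/-- The trace of a preirreducible set on an open set is preirreducible. [folklore] -/
theorem isPreirreducible_inter_of_isOpen {X : Type*} [TopologicalSpace X] {t u : Set X}
    (ht : IsPreirreducible t) (hu : IsOpen u) : IsPreirreducible (t ∩ u) := by
  rintro a b ha hb ⟨x, ⟨hxt, hxu⟩, hxa⟩ ⟨y, ⟨hyt, hyu⟩, hyb⟩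
  obtain ⟨z, hzt, ⟨hza, hzu⟩, hzb, -⟩ :=
    ht (a ∩ u) (b ∩ u) (ha.inter hu) (hb.inter hu) ⟨x, hxt, hxa, hxu⟩ ⟨y, hyt, hyb, hyu⟩
  exact ⟨z, ⟨hzt, hzu⟩, hza, hzb⟩

/-- The preimage under an inducing map of a preirreducible subset of its range is preirreducible.
[folklore] -/
theorem isPreirreducible_preimage_of_isInducing {X Y : Type*} [TopologicalSpace X] [TopologicalSpace Y]
    {f : X → Y} (hf : IsInducing f) {t : Set Y} (ht : IsPreirreducible t) (hsub : t ⊆ Set.range f) :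
    IsPreirreducible (f ⁻¹' t) := by
  rintro u v hu hv ⟨x, hx, hxu⟩ ⟨y, hy, hyv⟩
  obtain ⟨u', hu', rfl⟩ := hf.isOpen_iff.mp hu
  obtain ⟨v', hv', rfl⟩ := hf.isOpen_iff.mp hv
  obtain ⟨z, hzt, hzu', hzv'⟩ := ht u' v' hu' hv' ⟨f x, hx, hxu⟩ ⟨f y, hy, hyv⟩
  obtain ⟨w, rfl⟩ := hsub hzt
  exact ⟨w, hzt, hzu', hzv'⟩

/-! ## The registered sub-goal -/

/-- **A smooth scheme over a DVR with a section whose ideal is nonzero has a point of the special fibre off the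
section.** Let `O` be a discrete valuation ring, `U` an integral scheme, `r : U → Spec O` smooth and separated with
a section `s` (`s ≫ r = 𝟙`) such that `ker s ≠ ⊥`. Then some point of the special fibre `r⁻¹(s₀)` differs from
`s(s₀)`. Proof: otherwise, on an affine open `Spec R ∋ s(s₀)` the prime `𝔭₁` of `s(s₀)` is the only prime
containing the uniformizer `ϖ`, and `R/ϖR` is reduced (a smooth algebra over the residue field), so `𝔭₁ = ϖR`; the
ideal `I = ker (R → O)` of the section is a nonzero prime, `I ⊆ 𝔭₁`, `ϖ ∉ I`, hence `I ⊆ ⋂ₙ ϖⁿR = 0` (Krull's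
intersection theorem). [folklore] -/
theorem exists_mem_specialFibre_ne_of_section : ∀ (O : Type) [CommRing O] [IsDomain O] [IsDiscreteValuationRing O] (U : AlgebraicGeometry.Scheme.{0}) [AlgebraicGeometry.IsIntegral U] (r : U ⟶ AlgebraicGeometry.Spec (.of O)) [AlgebraicGeometry.Smooth r] [AlgebraicGeometry.IsSeparated r] (s : AlgebraicGeometry.Spec (.of O) ⟶ U), CategoryTheory.CategoryStruct.comp s r = CategoryTheory.CategoryStruct.id _ → s.ker ≠ ⊥ → ∃ u : U, r u = IsLocalRing.closedPoint O ∧ u ≠ s (IsLocalRing.closedPoint O) := by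
  intro O _ _ _ U _ r _ _ s hs hker
  classical
  by_contra hdeg
  push Not at hdeg
  set s₀ := IsLocalRing.closedPoint O with hs₀def
  set z₁ : U := s s₀ with hz₁def
  have hrs : ∀ t, r (s t) = t := fun t => by
    rw [← Scheme.Hom.comp_apply, hs]; rfl
  haveI : IsLocallyNoetherian U := LocallyOfFiniteType.isLocallyNoetherian r
  -- (1) an affine chart `V ∋ z₁`, `R = Γ(U, V)`, the smooth structure map `ρ : O → R`
  obtain ⟨V, hV, hzV, -⟩ := exists_isAffineOpen_mem_and_subset (X := U) (x := z₁) (U := ⊤) trivial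
  have e : V ≤ r ⁻¹ᵁ ⊤ := fun _ _ => trivial
  haveI : Nonempty V := ⟨⟨z₁, hzV⟩⟩
  haveI : IsNoetherianRing Γ(U, V) := IsLocallyNoetherian.component_noetherian ⟨V, hV⟩
  haveI : IsDomain Γ(U, V) := IsIntegral.component_integral V
  let ρ₀ : Γ(Spec (.of O), ⊤) →+* Γ(U, V) := (r.appLE ⊤ V e).hom
  have hρ₀ : ρ₀.Smooth := Scheme.Hom.smooth_appLE r (isAffineOpen_top _) hV e
  have hιbij : Function.Bijective (Scheme.ΓSpecIso (.of O)).inv :=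
    ConcreteCategory.bijective_of_isIso (Scheme.ΓSpecIso (.of O)).inv
  let ρ : O →+* Γ(U, V) := ρ₀.comp (Scheme.ΓSpecIso (.of O)).inv.hom
  have hρ : ρ.Smooth := RingHom.Smooth.comp (RingHom.Smooth.of_bijective hιbij) hρ₀
  letI : Algebra O Γ(U, V) := ρ.toAlgebra
  haveI : Algebra.Smooth O Γ(U, V) := hρ.toAlgebra
  -- the uniformizer and its image `p ∈ R`
  obtain ⟨ϖ, hϖ⟩ := IsDiscreteValuationRing.exists_irreducible O
  have hmax : IsLocalRing.maximalIdeal O = Ideal.span {ϖ} := hϖ.maximalIdeal_eq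
  set π' : Γ(Spec (.of O), ⊤) := (Scheme.ΓSpecIso (.of O)).inv ϖ with hπ'def
  set p : Γ(U, V) := ρ₀ π' with hpdef
  have hρϖ : ρ ϖ = p := rfl
  -- (2) points of `V` over the closed point are the primes containing `p`
  have hpt : ∀ x : U, r x = s₀ ↔ ϖ ∈ (r x).asIdeal := by
    intro x
    constructor
    · intro h
      rw [h]
      exact (IsLocalRing.mem_maximalIdeal _).mpr hϖ.not_isUnit
    · intro h
      apply PrimeSpectrum.ext
      refine ((IsLocalRing.maximalIdeal.isMaximal O).eq_of_le (r x).isPrime.ne_top ?_).symm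
      rw [hmax, Ideal.span_singleton_le_iff_mem]
      exact h
  have hbasic : U.basicOpen p = V ⊓ r ⁻¹ᵁ (Spec (.of O)).basicOpen π' := by
    rw [hpdef]; exact Scheme.basicOpen_appLE r V ⊤ e π'
  have hπ'basic : (Spec (.of O)).basicOpen π' = PrimeSpectrum.basicOpen ϖ := by
    rw [hπ'def]; exact basicOpen_eq_of_affine (R := CommRingCat.of O) ϖ
  have hfrom : ∀ 𝔮 : PrimeSpectrum Γ(U, V), r (hV.fromSpec 𝔮) = s₀ ↔ p ∈ 𝔮.asIdeal := by
    intro 𝔮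
    rw [hpt, ← not_iff_not]
    have h1 : ϖ ∉ (r (hV.fromSpec 𝔮)).asIdeal ↔ hV.fromSpec 𝔮 ∈ U.basicOpen p := by
      rw [← PrimeSpectrum.mem_basicOpen, hbasic]
      change _ ↔ hV.fromSpec 𝔮 ∈ (V : Set U) ∩ _
      constructor
      · intro h
        refine ⟨?_, ?_⟩
        · rw [← hV.range_fromSpec]; exact ⟨𝔮, rfl⟩
        · change r (hV.fromSpec 𝔮) ∈ (Spec (.of O)).basicOpen π'
          rw [hπ'basic]; exact h
      · rintro ⟨-, h⟩
        change r (hV.fromSpec 𝔮) ∈ (Spec (.of O)).basicOpen π' at h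
        rw [hπ'basic] at h; exact h
    have h2 : hV.fromSpec 𝔮 ∈ U.basicOpen p ↔ p ∉ 𝔮.asIdeal := by
      rw [← PrimeSpectrum.mem_basicOpen (R := Γ(U, V)), ← hV.fromSpec_preimage_basicOpen p]
      rfl
    rw [h1, h2]
  -- the prime `𝔭₁` of `z₁`; it contains `p`, and it is the ONLY prime containing `p`
  set 𝔭₁ : PrimeSpectrum Γ(U, V) := hV.primeIdealOf ⟨z₁, hzV⟩ with h𝔭₁def
  have hz₁from : hV.fromSpec 𝔭₁ = z₁ := hV.fromSpec_primeIdealOf ⟨z₁, hzV⟩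
  have hp𝔭₁ : p ∈ 𝔭₁.asIdeal := by
    rw [← hfrom, hz₁from, hz₁def, hrs]
  have honly : ∀ 𝔮 : PrimeSpectrum Γ(U, V), p ∈ 𝔮.asIdeal → 𝔮 = 𝔭₁ := by
    intro 𝔮 h𝔮
    have h1 : hV.fromSpec 𝔮 = z₁ := hdeg _ ((hfrom 𝔮).mpr h𝔮)
    rw [← hz₁from] at h1
    exact hV.fromSpec.isOpenEmbedding.injective h1
  -- (3) `R / p R` is reduced: it is `κ ⊗_O R`, a smooth algebra over the residue field `κ`
  have hmapρ : (IsLocalRing.maximalIdeal O).map (algebraMap O Γ(U, V)) = Ideal.span {p} := by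
    rw [hmax, Ideal.map_span, Set.image_singleton]
    rfl
  haveI hred : _root_.IsReduced (Γ(U, V) ⧸ Ideal.span {p}) := by
    letI : Field (O ⧸ IsLocalRing.maximalIdeal O) := Ideal.Quotient.field _
    have hsm : Smooth (Spec.map (CommRingCat.ofHom (algebraMap (O ⧸ IsLocalRing.maximalIdeal O)
        ((O ⧸ IsLocalRing.maximalIdeal O) ⊗[O] Γ(U, V))))) := by
      rw [HasRingHomProperty.Spec_iff (P := @Smooth), CommRingCat.hom_ofHom, RingHom.smooth_algebraMap]
      infer_instance
    haveI := isReduced_of_smooth (Spec.map (CommRingCat.ofHom (algebraMap (O ⧸ IsLocalRing.maximalIdeal O)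
        ((O ⧸ IsLocalRing.maximalIdeal O) ⊗[O] Γ(U, V)))))
    haveI h1 : _root_.IsReduced ((O ⧸ IsLocalRing.maximalIdeal O) ⊗[O] Γ(U, V)) :=
      isReduced_of_injective
        (Scheme.ΓSpecIso (.of ((O ⧸ IsLocalRing.maximalIdeal O) ⊗[O] Γ(U, V)))).commRingCatIsoToRingEquiv.symm
        (RingEquiv.injective _)
    rw [← hmapρ]
    exact isReduced_of_injective
      (Algebra.TensorProduct.quotIdealMapEquivQuotTensor Γ(U, V) (IsLocalRing.maximalIdeal O)).toRingEquiv
      (RingEquiv.injective _)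
  -- hence `𝔭₁ ⊆ p R`
  have h𝔭₁le : 𝔭₁.asIdeal ≤ Ideal.span {p} := by
    intro x hx
    rw [← Ideal.Quotient.eq_zero_iff_mem]
    apply IsNilpotent.eq_zero
    rw [← mem_nilradical, nilradical_eq_sInf, Ideal.mem_sInf]
    rintro J (hJ : J.IsPrime)
    let 𝔮 : PrimeSpectrum Γ(U, V) := ⟨J.comap (Ideal.Quotient.mk (Ideal.span {p})), inferInstance⟩
    have hp𝔮 : p ∈ 𝔮.asIdeal := by
      change Ideal.Quotient.mk (Ideal.span {p}) p ∈ J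
      rw [Ideal.Quotient.eq_zero_iff_mem.mpr (Ideal.mem_span_singleton_self p)]
      exact J.zero_mem
    have h := honly 𝔮 hp𝔮
    have hx' : x ∈ 𝔮.asIdeal := by rw [h]; exact hx
    exact hx'
  -- (4) the ideal `I` of the section on `V`: a nonzero prime inside `𝔭₁` not containing `p`
  haveI : IsClosedImmersion s :=
    haveI : IsClosedImmersion (s ≫ r) := by rw [hs]; infer_instance
    .of_comp s r
  have hsV : s ⁻¹ᵁ V = ⊤ := (IsLocalRing.closedPoint_mem_iff _).mp hzV
  set I : Ideal Γ(U, V) := s.ker.ideal ⟨V, hV⟩ with hIdef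
  have hI : I = RingHom.ker (s.app V).hom := Scheme.Hom.ker_apply s ⟨V, hV⟩
  haveI : IsDomain Γ(Spec (.of O), s ⁻¹ᵁ V) := by
    rw [hsV]
    exact (ConcreteCategory.bijective_of_isIso (Scheme.ΓSpecIso (.of O)).hom).1.isDomain
      (Scheme.ΓSpecIso (.of O)).hom.hom
  have hIprime : I.IsPrime := by rw [hI]; exact RingHom.ker_isPrime _
  have hmemD : ∀ g : Γ(U, V), z₁ ∈ U.basicOpen g ↔ g ∉ 𝔭₁.asIdeal := by
    intro g
    rw [← PrimeSpectrum.mem_basicOpen, ← hV.fromSpec_preimage_basicOpen g]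
    change _ ↔ hV.fromSpec 𝔭₁ ∈ U.basicOpen g
    rw [hz₁from]
  have hsupp : (s.ker.support : Set U) = closure (Set.range s) := Scheme.Hom.support_ker s
  have hI𝔭₁ : I ≤ 𝔭₁.asIdeal := by
    intro f hf
    have hz : z₁ ∈ s.ker.support := by
      rw [← SetLike.mem_coe, hsupp]; exact subset_closure ⟨s₀, rfl⟩
    have hz' := (Scheme.IdealSheafData.mem_support_iff_of_mem (I := s.ker) (U := ⟨V, hV⟩) hzV).mp hz
    rw [Scheme.mem_zeroLocus_iff] at hz'
    by_contra hfp
    exact hz' f hf ((hmemD f).mpr hfp)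
  have hIne : I ≠ ⊥ := by
    intro hI0
    apply hker
    rw [← Scheme.IdealSheafData.support_eq_top_iff]
    have hVsub : (V : Set U) ⊆ s.ker.support := by
      intro x hx
      refine (Scheme.IdealSheafData.mem_support_iff_of_mem (I := s.ker) (U := ⟨V, hV⟩) hx).mpr ?_
      rw [Scheme.mem_zeroLocus_iff]
      intro f hf
      have hf0 : f = 0 := by
        change f ∈ I at hf
        rwa [hI0, Ideal.mem_bot] at hf
      rw [hf0, Scheme.basicOpen_zero]
      exact id
    have hdense : Dense (V : Set U) := V.2.dense ⟨z₁, hzV⟩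
    apply TopologicalSpace.Closeds.ext
    rw [TopologicalSpace.Closeds.coe_top]
    apply Set.eq_univ_of_univ_subset
    rw [← hdense.closure_eq]
    exact s.ker.support.isClosed.closure_subset_iff.mpr hVsub
  -- `p ∉ I`: the section pulls `p` back to the restriction of `π' ≠ 0`
  have hcomp : r.appLE ⊤ V e ≫ s.app V =
      (Spec (.of O)).presheaf.map (homOfLE (le_top : s ⁻¹ᵁ V ≤ ⊤)).op := by
    have hid : ∀ {g : Spec (.of O) ⟶ Spec (.of O)}, g = 𝟙 _ → ∀ (W : (Spec (.of O)).Opens)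
        (e' : W ≤ g ⁻¹ᵁ ⊤), g.appLE ⊤ W e' = (Spec (.of O)).presheaf.map (homOfLE (le_top : W ≤ ⊤)).op := by
      rintro g rfl W e'
      simp only [Scheme.Hom.appLE, Scheme.Hom.id_app]
      rfl
    rw [Scheme.Hom.app_eq_appLE s, Scheme.Hom.appLE_comp_appLE]
    exact hid hs _ _
  have hres : ∀ (W : (Spec (.of O)).Opens), W = ⊤ → ∀ t : Γ(Spec (.of O), ⊤),
      (Spec (.of O)).presheaf.map (homOfLE (le_top : W ≤ ⊤)).op t = 0 → t = 0 := by
    rintro W rfl t ht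
    simpa using ht
  have hπ'ne : π' ≠ 0 := by
    rw [hπ'def]
    exact (map_ne_zero_iff _ hιbij.1).mpr hϖ.ne_zero
  have hpI : p ∉ I := by
    rw [hI, RingHom.mem_ker]
    intro h0
    apply hπ'ne
    refine hres (s ⁻¹ᵁ V) hsV π' ?_
    rw [← hcomp]
    exact h0
  -- (5) Krull's intersection theorem: a nonzero `a ∈ I` lies in every power of `p R ⊇ 𝔭₁ ⊇ I`
  obtain ⟨a, haI, ha0⟩ := Submodule.exists_mem_ne_zero_of_ne_bot hIne
  have hstep : ∀ b ∈ I, ∃ c ∈ I, b = p * c := by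
    intro b hb
    obtain ⟨c, hc⟩ := Ideal.mem_span_singleton'.mp (h𝔭₁le (hI𝔭₁ hb))
    have hpc : p * c ∈ I := by rw [mul_comm, hc]; exact hb
    exact ⟨c, (hIprime.mem_or_mem hpc).resolve_left hpI, by rw [mul_comm, hc]⟩
  have hpow : ∀ n : ℕ, ∃ c ∈ I, a = p ^ n * c := by
    intro n
    induction n with
    | zero => exact ⟨a, haI, by simp⟩
    | succ n ih =>
      obtain ⟨c, hc, hac⟩ := ih
      obtain ⟨c', hc', hcc'⟩ := hstep c hc
      exact ⟨c', hc', by rw [hac, hcc', pow_succ, mul_assoc]⟩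
  have hptop : Ideal.span {p} ≠ ⊤ := fun h =>
    𝔭₁.isPrime.ne_top (top_le_iff.mp (h ▸ (Ideal.span_singleton_le_iff_mem _).mpr hp𝔭₁))
  have hainf : a ∈ ⨅ n : ℕ, Ideal.span {p} ^ n := by
    rw [Ideal.mem_iInf]
    intro n
    obtain ⟨c, -, hac⟩ := hpow n
    rw [hac, Ideal.span_singleton_pow]
    exact Ideal.mul_mem_right _ _ (Ideal.mem_span_singleton_self _)
  rw [Ideal.iInf_pow_eq_bot_of_isDomain _ hptop, Ideal.mem_bot] at hainf
  exact ha0 hainf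

end Summit.ResolutionOfSingularities.ResolutionOfSingularities.Cruxes.EquisingularLift.StrataSplit

end
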